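import Summits.CriticalPhenomena.SAWScalingLimit.Theorems.SAWDefectDecoherenceBoundaryClosureRTransportPairing
import Summits.CriticalPhenomena.SAWScalingLimit.Theorems.SAWDefectDecoherenceBoundaryClosureRTransportCorner
import Summits.CriticalPhenomena.SAWScalingLimit.Theorems.SAWDefectDecoherenceBoundaryClosureRTransportRoot
import Summits.CriticalPhenomena.SAWScalingLimit.Theorems.SAWDefectDecoherenceBoundaryClosureRRealLineRigidity
import Literature.Analysis.Complex.CousinProblems
import HarnessLib

/-!
# `BoundaryClosureR` (stmt-CriticalPhenomena-14004), line `polygon-parity-squeeze`: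
# stub `transportRigidity` — piece (E) of the (A) assembly, the identification itself

On an exact-sided lattice polygon (flat sides of the six zigzag forms, genuine lattice corners,
the root `a = D.pt 0` on a flat piece), let `(Φ, L, L_b)` be a conformal frame (`Φ : Ω → ℍₒ`,
`a ↦ ∞`, `e^L = Φ'`), and let `(g, μ, κ)` be limit data: `g` holomorphic on `Ω`, integrable on
compacts up to the boundary (root included), `μ` a positive boundary measure finite off the root,
`κ` unit side phases with the LOCAL CONTINUUM IDENTITY (K2i) `∫_Ω g ∂̄φ = -√3 n_k κ ∫ φ dμ` on flat
discs, locally constant phases (K2c) and the phase relation (PHASE)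
`κ n_k e^{i(3/8)α} = i e^{i(3/8) im L_b}` (`α` the boundary value of `im L`).  THEN
`g = c · e^{(5/8)(L - L_b)}` on `Ω` for a constant `c`.

Proof: transport to the half-plane and apply the landed `realLine_rigidity` to
`K := (g e^{-(5/8)(L - L_b)}) ∘ Φ⁻¹`, the corner images `X := Φ*(corners)`, the one phase `θ₀`
(`√3 e^{(5/8) re L_b} e^{iθ₀} = -√3 i e^{i(3/8) im L_b} e^{(5/8) L_b}`) and the transported measure
`ν := (re Φ*)_* (c₀ wt μ|_{flat part})` (`wt = lim |Φ'|^{3/8}` from inside): `hpair` at every real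
`y ∉ X` is `Transport.flat_pairing` (F4b) at the flat preimage `Φ*⁻¹(y)` (`frameExt_surj_real`),
`hcorner` is `Transport.corner_bounds` (F5a), `hinf` is `Transport.root_decay` (F5b).  `K` is then
constant on `ℍₒ`, i.e. `g = c e^{(5/8)(L - L_b)}`.

References: H. Duminil-Copin, S. Smirnov, Ann. of Math. 175 (2012), §3 and Conjecture 2;
Pommerenke, *Boundary Behaviour of Conformal Maps* (1992), Thms. 2.6, 3.9.
-/

noncomputable section

open scoped Topology ComplexConjugate ContDiff ENNReal Classical
open Filter Set Metric Complex MeasureTheory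
open UpperHalfPlane (upperHalfPlaneSet)
open Literature.Probability.LatticeModels Literature.Probability.RandomPlanarGeometry
open Literature.Analysis.Complex (dbarAlong)

namespace Summit.CriticalPhenomena.SAWScalingLimit.Theorems.PolygonParitySqueeze

open Transport

/-- The modulus of the pairing constant: `‖-√3 i e^{i(3/8) im L_b} e^{(5/8) L_b}‖ = √3 e^{(5/8) re L_b}`.
[folklore] -/
theorem norm_pairingConstant (Lb : ℂ) :
    ‖-(Real.sqrt 3 : ℂ) * I * Complex.exp ((3 / 8 : ℂ) * (Lb.im : ℂ) * I) * Complex.exp ((5 / 8 : ℂ) * Lb)‖ =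
      Real.sqrt 3 * Real.exp ((5 / 8 : ℝ) * Lb.re) := by
  rw [norm_mul, norm_mul, norm_mul, norm_neg, norm_real, norm_I, mul_one, Real.norm_eq_abs,
    abs_of_nonneg (Real.sqrt_nonneg 3), show (3 / 8 : ℂ) * (Lb.im : ℂ) * I = (((3 / 8 : ℝ) * Lb.im : ℝ) : ℂ) * I
    by push_cast; ring, norm_exp_ofReal_mul_I, mul_one, Complex.norm_exp]
  congr 2
  simp [Complex.mul_re]

/-- **Stub `transportRigidity`** (piece (E) of the (A) assembly of line `polygon-parity-squeeze`,
crux stmt-CriticalPhenomena-14004 `BoundaryClosureR`): the identification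
`g = c · exp((5/8)(L - L_b))` of a limit observable satisfying the local boundary identities on an
exact polygon (see the module docstring).
[cite: DuminilCopinSmirnov2012, §3 (boundary behaviour of the observable) and Conjecture 2] -/
theorem transportRigidity : ∀ (D : DobrushinDomain) (ρ : ℝ) (Λ : ℝ → Finset HexVertex) (m : ℝ → ℤ) (b : ℝ → Sym2 HexVertex), AdmissibleFamily D ρ Λ m b → ExactPolygonFamily D Λ → ∀ (a : ℝ → Sym2 HexVertex) (r₀ : ℝ) (m₀ : ℝ → ℤ), PinnedFlatRoot D Λ b (D.pt 0) a r₀ m₀ → 2 * ρ < dist (D.pt 0) (D.pt 1) → ∀ (corners : Finset ℂ), (↑corners : Set ℂ) ⊆ frontier D.carrier → (∀ z ∈ frontier D.carrier, z ≠ D.pt 0 → z ∉ corners → ∃ (k : Fin 6) (s : ℝ), 0 < s ∧ D.carrier ∩ Metric.ball z s = halfPlane k z ∩ Metric.ball z s ∧ (∀ᶠ δ : ℝ in 𝓝[>] 0, ∃ nthr : ℤ, ∀ v : HexVertex, (δ : ℂ) * hexCenter v ∈ Metric.ball z s → (v ∈ Λ δ ↔ nthr ≤ zigzagForm k v)) ∧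 D.pt 0 ∉ Metric.closedBall z s) → (∀ c ∈ corners, ∃ (k k' : Fin 6) (s : ℝ), 0 < s ∧ innerNormal k' ≠ innerNormal k ∧ innerNormal k' ≠ -innerNormal k ∧ (D.carrier ∩ Metric.ball c s = halfPlane k c ∩ halfPlane k' c ∩ Metric.ball c s ∨ D.carrier ∩ Metric.ball c s = (halfPlane k c ∪ halfPlane k' c) ∩ Metric.ball c s) ∧ D.pt 0 ∉ Metric.closedBall c s) → ∀ (Φ : ConformalEquiv D.carrier UpperHalfPlane.upperHalfPlaneSet) (L : ℂ → ℂ) (Lb : ℂ), ConformalFrame D Φ L Lb → ∀ (g : ℂ → ℂ) (μ : MeasureTheory.Measure ℂ), DifferentiableOn ℂ g D.carrier → (∀ K : Set ℂ, IsCompact K → MeasureTheory.IntegrableOn g (K ∩ D.carrier)) → (∀ K : Set ℂ, IsCompact K → D.pt 0 ∉ K → μ K < ⊤) → μ (frontier D.carrier)ᶜ = 0 → ∀ (κ : ℂ → ℂ), (∀ z ∈ frontier D.carrier, ‖κ z‖ = 1) → (∀ z ∈ frontier D.carrier, z ≠ D.pt 0 → ∀ (k : Fin 6) (s : ℝ),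 0 < s → D.carrier ∩ Metric.ball z s = halfPlane k z ∩ Metric.ball z s → (∀ᶠ δ : ℝ in 𝓝[>] 0, ∃ nthr : ℤ, ∀ v : HexVertex, (δ : ℂ) * hexCenter v ∈ Metric.ball z s → (v ∈ Λ δ ↔ nthr ≤ zigzagForm k v)) → D.pt 0 ∉ Metric.closedBall z s → ∀ z' ∈ frontier D.carrier ∩ Metric.ball z s, κ z' = κ z) → (∀ z ∈ frontier D.carrier, z ≠ D.pt 0 → ∀ (k : Fin 6) (s : ℝ), 0 < s → D.carrier ∩ Metric.ball z s = halfPlane k z ∩ Metric.ball z s → (∀ᶠ δ : ℝ in 𝓝[>] 0, ∃ nthr : ℤ, ∀ v : HexVertex, (δ : ℂ) * hexCenter v ∈ Metric.ball z s → (v ∈ Λ δ ↔ nthr ≤ zigzagForm k v)) → D.pt 0 ∉ Metric.closedBall z s → ∀ φ : ℂ → ℂ, ContDiff ℝ ∞ φ → HasCompactSupport φ → tsupport φ ⊆ Metric.ball z (s / 2) → ∫ w in D.carrier, g w * Literature.Analysis.Complex.dbarAlong 1 φ w = -(Real.sqrt 3 : ℂ) * innerNormal k * κ z * ∫ w, φ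 w ∂μ) → (∀ z ∈ frontier D.carrier ∩ Metric.ball (D.pt 1) ρ, κ z = 1) → (∀ z ∈ frontier D.carrier, ∀ (k k' : Fin 6) (s : ℝ), 0 < s → innerNormal k' ≠ innerNormal k → innerNormal k' ≠ -innerNormal k → (D.carrier ∩ Metric.ball z s = halfPlane k z ∩ halfPlane k' z ∩ Metric.ball z s ∨ D.carrier ∩ Metric.ball z s = (halfPlane k z ∪ halfPlane k' z) ∩ Metric.ball z s) → (∀ᶠ δ : ℝ in 𝓝[>] 0, ∃ nk nk' : ℤ, (∀ v : HexVertex, (δ : ℂ) * hexCenter v ∈ Metric.ball z s → (v ∈ Λ δ ↔ (nk ≤ zigzagForm k v ∧ nk' ≤ zigzagForm k' v))) ∨ (∀ v : HexVertex, (δ : ℂ) * hexCenter v ∈ Metric.ball z s → (v ∈ Λ δ ↔ (nk ≤ zigzagForm k v ∨ nk' ≤ zigzagForm k' v)))) → D.pt 0 ∉ Metric.closedBall z s → ∀ z₁ ∈ frontier D.carrier ∩ Metric.ball z s, ∀ z₂ ∈ frontier D.carrier ∩ Metric.ball z s, z₁ ≠ z → ((z₁ - z) * (starRingEnd ℂ)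 (innerNormal k)).re = 0 → z₂ ≠ z → ((z₂ - z) * (starRingEnd ℂ) (innerNormal k')).re = 0 → κ z₂ = Complex.exp (-(5 / 8 : ℂ) * (Complex.arg (innerNormal k' / innerNormal k) : ℂ) * Complex.I) * κ z₁) → (∀ z ∈ frontier D.carrier, z ≠ D.pt 0 → ∀ (k : Fin 6) (s : ℝ), 0 < s → D.carrier ∩ Metric.ball z s = halfPlane k z ∩ Metric.ball z s → (∀ᶠ δ : ℝ in 𝓝[>] 0, ∃ nthr : ℤ, ∀ v : HexVertex, (δ : ℂ) * hexCenter v ∈ Metric.ball z s → (v ∈ Λ δ ↔ nthr ≤ zigzagForm k v)) → D.pt 0 ∉ Metric.closedBall z s → ∃ α : ℝ, Filter.Tendsto (fun w => (L w).im) (𝓝[D.carrier] z) (𝓝 α) ∧ κ z * innerNormal k * Complex.exp ((3 / 8 : ℂ) * (α : ℂ) * Complex.I) = Complex.I * Complex.exp ((3 / 8 : ℂ) * (Lb.im : ℂ) * Complex.I)) → ∃ c : ℂ, ∀ w ∈ D.carrier, g w = c * Complex.exp ((5 / 8 : ℂ) * (L w - Lb)) := by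
  intro D ρ Λ m b _hAdm _hEx a r₀ m₀ hPin _h2ρ corners hCsub hFLAT hCORN Φ L Lb hFrame g μ hg hgi hμK hμs
    κ _hK1 hK2c hK2i _hK3 _hK4 hPH
  have hU : IsOpen D.carrier := D.isOpen
  obtain ⟨hΦ0, hΦ1, hLc, hexp, -⟩ := hFrame
  obtain ⟨Φs, hΦsc, hΦse, hΦsr, hΦsi⟩ := GateStability.exists_frameExtension_injOn D Φ hΦ0
  -- `L` is holomorphic
  have hLd : DifferentiableOn ℂ L D.carrier :=
    Literature.Analysis.Complex.differentiableOn_of_continuousOn_of_exp hU hLc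
      (((Φ.differentiableOn.analyticOnNhd hU).deriv.differentiableOn).congr fun z hz => hexp z hz)
  -- the flat part of the boundary and the objects `wt`, `c₀`, `θ₀`, `ν`, `K`, `X`
  set Gs : Set ℂ := frontier D.carrier \ insert (D.pt 0) (↑corners : Set ℂ) with hGs
  have hGm : MeasurableSet Gs :=
    isClosed_frontier.measurableSet.diff (corners.finite_toSet.insert (D.pt 0)).measurableSet
  have hGsub : Gs ⊆ frontier D.carrier \ {D.pt 0} := fun z hz => ⟨hz.1, fun h => hz.2 (Or.inl h)⟩
  have hGsub' : Gs ⊆ closure D.carrier \ {D.pt 0} := fun z hz => ⟨frontier_subset_closure hz.1, (hGsub hz).2⟩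
  set wt : ℂ → ℝ := fun z => Real.exp ((3 / 8 : ℝ) * limUnder (𝓝[D.carrier] z) (fun w => (L w).re)) with hwt
  set c₀ : ℝ := Real.sqrt 3 * Real.exp ((5 / 8 : ℝ) * Lb.re) with hc₀
  have hc₀0 : 0 < c₀ := by positivity
  set C₀ : ℂ := -(Real.sqrt 3 : ℂ) * I * Complex.exp ((3 / 8 : ℂ) * (Lb.im : ℂ) * I) *
    Complex.exp ((5 / 8 : ℂ) * Lb) with hC₀
  set θ₀ : ℝ := arg C₀ with hθ₀
  have hC : (c₀ : ℂ) * Complex.exp ((θ₀ : ℂ) * I) = C₀ := by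
    have h := norm_mul_exp_arg_mul_I C₀
    rwa [show ‖C₀‖ = c₀ from norm_pairingConstant Lb] at h
  set ν : Measure ℝ := Measure.map (fun z => (Φs z).re)
    ((μ.restrict Gs).withDensity fun z => ENNReal.ofReal (c₀ * wt z)) with hν
  set K : ℂ → ℂ := fun w => g (Φ.symm w) * Complex.exp (-(5 / 8 : ℂ) * (L (Φ.symm w) - Lb)) with hKdef
  have hK : ∀ w : ℂ, 0 < w.im → K w = g (Φ.symm w) * Complex.exp (-(5 / 8 : ℂ) * (L (Φ.symm w) - Lb)) :=
    fun w _ => rfl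
  set X : Finset ℝ := corners.image fun c => (Φs c).re with hX
  -- measurability of the boundary data on the flat part
  have hΦrm : AEMeasurable (fun z => (Φs z).re) (μ.restrict Gs) :=
    (Complex.continuous_re.comp_continuousOn (hΦsc.mono hGsub')).aemeasurable hGm
  have hwtm : AEMeasurable wt (μ.restrict Gs) := by
    refine (ContinuousOn.aemeasurable ?_ hGm)
    intro z hz
    have hzf : z ∈ frontier D.carrier := hz.1
    have hz0 : z ≠ D.pt 0 := (hGsub hz).2
    have hzc : z ∉ corners := fun h => hz.2 (Or.inr h)
    obtain ⟨k, s, hs, hflat, -, h0⟩ := hFLAT z hzf hz0 hzc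
    obtain ⟨s₁, G, M, hs₁, hs₁s, -, -, -, -, -, -, hMd, -, hML⟩ := exists_frameChart D Φ hΦsc hΦse hΦsr hΦsi
      hLc hexp (norm_innerNormal k) hs hflat h0
    have hwtz : ∀ w ∈ closure D.carrier ∩ ball z s₁, wt w = Real.exp ((3 / 8 : ℝ) * (M w).re) := by
      intro w hw
      haveI : NeBot (𝓝[D.carrier] w) := mem_closure_iff_nhdsWithin_neBot.1 hw.1
      have h1 : Tendsto (fun v => (L v).re) (𝓝[D.carrier] w) (𝓝 (M w).re) :=
        (Complex.continuous_re.tendsto _).comp (chart_tendsto hMd.continuousOn hML hw.2)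
      simp only [hwt]; rw [h1.limUnder_eq]
    have hcont : ContinuousAt (fun w => Real.exp ((3 / 8 : ℝ) * (M w).re)) z :=
      (Real.continuous_exp.continuousAt).comp (((Complex.continuous_re.continuousAt).comp
        (hMd.continuousOn.continuousAt (isOpen_ball.mem_nhds (mem_ball_self hs₁)))).const_smul (3 / 8 : ℝ))
    refine (hcont.continuousWithinAt).congr_of_eventuallyEq ?_ (hwtz z ⟨frontier_subset_closure hzf, mem_ball_self hs₁⟩)
    filter_upwards [mem_nhdsWithin_of_mem_nhds (isOpen_ball.mem_nhds (mem_ball_self hs₁)), self_mem_nhdsWithin]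
      with w hw hwG
    exact hwtz w ⟨frontier_subset_closure hwG.1, hw⟩
  -- (1) `K` is holomorphic on the upper half-plane
  have hKd : DifferentiableOn ℂ K {w : ℂ | 0 < w.im} := by
    have hψ : DifferentiableOn ℂ Φ.symm {w : ℂ | 0 < w.im} := Φ.symm.differentiableOn
    have hψm : MapsTo Φ.symm {w : ℂ | 0 < w.im} D.carrier := Φ.symm_mapsTo
    exact (hg.comp hψ hψm).mul (((hLd.comp hψ hψm).sub_const Lb).const_smul (-(5 / 8 : ℂ))).cexp
  -- (2) the one-phase pairing at every real point off the corner images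
  have hpair : ∀ y : ℝ, y ∉ X → ∃ r : ℝ, 0 < r ∧ (∀ x ∈ X, r ≤ |y - x|) ∧ ν (Ioo (y - r) (y + r)) < ⊤ ∧
      IntegrableOn K (ball (y : ℂ) r ∩ {w : ℂ | 0 < w.im}) ∧
      ∀ φ : ℂ → ℂ, ContDiff ℝ ∞ φ → HasCompactSupport φ → tsupport φ ⊆ ball (y : ℂ) r →
        ∫ w in ball (y : ℂ) r ∩ {w : ℂ | 0 < w.im}, K w * dbarAlong 1 φ w =
          Complex.exp (θ₀ * I) * ∫ x in Ioo (y - r) (y + r), φ (x : ℂ) ∂ν := by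
    intro y hyX
    obtain ⟨z₀, hz₀f, hz₀0, hz₀y⟩ := frameExt_surj_real hΦ0 hΦsc hΦse y
    have hy : (Φs z₀).re = y := by rw [hz₀y, ofReal_re]
    have hz₀c : z₀ ∉ corners := fun h => hyX (Finset.mem_image.2 ⟨z₀, h, hy⟩)
    obtain ⟨k, s, hs, hflat, hlat, h0⟩ := hFLAT z₀ hz₀f hz₀0 hz₀c
    -- a flat disc avoiding the corners
    obtain ⟨ε, hε, hεc⟩ : ∃ ε : ℝ, 0 < ε ∧ ball z₀ ε ⊆ (↑corners : Set ℂ)ᶜ :=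
      Metric.isOpen_iff.1 corners.finite_toSet.isClosed.isOpen_compl z₀ hz₀c
    set s' : ℝ := min s ε with hs'
    have hs'0 : 0 < s' := lt_min hs hε
    have hsub : ball z₀ s' ⊆ ball z₀ s := ball_subset_ball (min_le_left _ _)
    have hflat' : D.carrier ∩ ball z₀ s' = halfPlane k z₀ ∩ ball z₀ s' := flatDir_subball hflat (by simp) hsub
    have hlat' : ∀ᶠ δ : ℝ in 𝓝[>] 0, ∃ nthr : ℤ, ∀ v : HexVertex,
        (δ : ℂ) * hexCenter v ∈ ball z₀ s' → (v ∈ Λ δ ↔ nthr ≤ zigzagForm k v) :=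
      hlat.mono fun δ ⟨nthr, h⟩ => ⟨nthr, fun v hv => h v (hsub hv)⟩
    have h0' : D.pt 0 ∉ closedBall z₀ s' := fun h => h0 (closedBall_subset_closedBall (min_le_left _ _) h)
    have hGball : frontier D.carrier ∩ ball z₀ s' ⊆ Gs := fun w hw =>
      ⟨hw.1, fun h => h.elim (fun h1 => h0' (h1 ▸ ball_subset_closedBall hw.2))
        fun h1 => hεc (ball_subset_ball (min_le_right _ _) hw.2) h1⟩
    -- a radius below the distance to the corner images
    obtain ⟨ε', hε', hε'X⟩ : ∃ ε' : ℝ, 0 < ε' ∧ ball y ε' ⊆ (↑X : Set ℝ)ᶜ :=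
      Metric.isOpen_iff.1 X.finite_toSet.isClosed.isOpen_compl y hyX
    have hXfar : ∀ x ∈ X, ε' ≤ |y - x| := fun x hx => by
      by_contra hlt
      push Not at hlt
      exact hε'X (by rw [mem_ball, Real.dist_eq, abs_sub_comm]; exact hlt) hx
    obtain ⟨r, hr0, hrle, hνr, hKint, hφ⟩ := flat_pairing D Λ Φ hΦsc hΦse hΦsr hΦsi hLc hexp hgi hμK hμs
      hK2c hK2i hPH hGm hGsub (fun z => rfl) hwtm hΦrm hc₀0 hC rfl hK hz₀f hs'0 hflat' hlat' h0' hGball hε'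
    rw [hy] at hνr hKint hφ
    exact ⟨r, hr0, fun x hx => hrle.trans (hXfar x hx), hνr, hKint, hφ⟩
  -- (3) the corner images
  have hcorner : ∀ x ∈ X, ∃ (r γ β : ℝ), 0 < r ∧ 0 ≤ γ ∧ γ < 1 ∧ 0 ≤ β ∧ β < 1 ∧
      IntegrableOn (fun w : ℂ => (‖w - (x : ℂ)‖ ^ γ : ℝ) * ‖K w‖) (ball (x : ℂ) r ∩ {w : ℂ | 0 < w.im}) ∧
      ∫⁻ t in Ioo (x - r) (x + r), ENNReal.ofReal (|t - x| ^ β) ∂ν < ⊤ := by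
    intro x hx
    obtain ⟨c, hcC, rfl⟩ := Finset.mem_image.1 hx
    obtain ⟨k, k', s, hs, hk, hk', hset, h0⟩ := hCORN c hcC
    have hcG : c ∉ Gs := fun h => h.2 (Or.inr hcC)
    exact corner_bounds D Φ hΦ0 hΦsc hΦse hΦsr hΦsi hLc hexp hgi hμK hGm hGsub (fun z => rfl) hwtm hΦrm hc₀0
      rfl hK (hCsub hcC) hcG hk hk' hs hset h0
  -- (4) decay at infinity (the root)
  have hinf : ∃ R : ℝ, IntegrableOn (fun w => ‖K w‖ * ‖w‖ ^ (-(11 / 4 : ℝ)))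
      ({w : ℂ | 0 < w.im} ∩ {w : ℂ | R < ‖w‖}) :=
    root_decay D Φ hΦ0 hΦ1 hΦsc hΦse hLc hexp hgi hPin.1 hPin.2.1 hK
  -- (5) rigidity on the real line, and back to `Ω`
  obtain ⟨cK, hcK⟩ := realLine_rigidity K X θ₀ ν hKd hpair hcorner hinf
  refine ⟨cK, fun w hw => ?_⟩
  have h1 := hcK (Φ w) (Φ.mapsTo hw)
  simp only [hKdef, Φ.symm_apply_apply hw] at h1
  have h2 : Complex.exp (-(5 / 8 : ℂ) * (L w - Lb)) * Complex.exp ((5 / 8 : ℂ) * (L w - Lb)) = 1 := by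
    rw [← Complex.exp_add, show -(5 / 8 : ℂ) * (L w - Lb) + (5 / 8 : ℂ) * (L w - Lb) = 0 by ring,
      Complex.exp_zero]
  calc g w = g w * (Complex.exp (-(5 / 8 : ℂ) * (L w - Lb)) * Complex.exp ((5 / 8 : ℂ) * (L w - Lb))) := by
        rw [h2, mul_one]
    _ = cK * Complex.exp ((5 / 8 : ℂ) * (L w - Lb)) := by rw [← mul_assoc, h1]

end Summit.CriticalPhenomena.SAWScalingLimit.Theorems.PolygonParitySqueeze
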